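import Summits.SmoothPoincare4.SmoothPoincare4.Theorems.EntropyRungChangGurskyYangOfBlowupLimit
import Summits.SmoothPoincare4.SmoothPoincare4.Theorems.EntropyRungChangGurskyYangOfGvPathFacts
import HarnessLib

/-!
# Route EntropyRung · crux `ChangGurskyYang` — the crux modulo {blow-up limit, GV×4}

The two worked lines of crux stmt-SmoothPoincare4-10834 merged: Margerin's leaf along line
`margerin-cone-hamilton-rails` is closed modulo the blow-up limit `ricciFlow_blowupLimit_four`
(`EntropyRungChangGurskyYangOfBlowupLimit.lean`, `hamilton_convergenceCriterion_four_of_blowupLimit`), and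
CGY Thm. 1.4 along line `gv-continuity-path` modulo the four Gursky–Viaclovsky weighted-path facts
(`changGurskyYang_theorem14_four_of_gvPathFacts`, p108727). Every remaining leaf of the crux is a
standard analytic named fact. No `sorry`, no definition.
-/

noncomputable section

-- every `Summit.SmoothPoincare4.SmoothPoincare4.…` name repeats the summit = sub-problem segment (D-0017 layout)
set_option linter.dupNamespace false

namespace Summit.SmoothPoincare4.SmoothPoincare4.Theorems.MargerinRails

open Literature.Geometry.Riemannian
open Summit.SmoothPoincare4.SmoothPoincare4.Theses.EntropyRung (ChangGurskyYang)
open Summit.SmoothPoincare4.SmoothPoincare4.Theorems.GvContinuityPath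
  (changGurskyYang_theorem14_four_of_gvPathFacts)

/-- **The crux from the blow-up limit and the four Gursky–Viaclovsky weighted-path facts** (line
`gv-continuity-path`'s decomposition of Thm. 1.4, `changGurskyYang_theorem14_four_of_gvPathFacts`,
p108727): the two worked lines of the crux merged — every remaining leaf is a standard analytic named
fact (Hamilton–Perelman compactness; GV 2003 Props. 5, 6, 2 and the Evans–Krylov closedness).
[cite: ChangGurskyYang2003, §2, p. 121] [cite: GurskyViaclovsky2003, Props. 4–6] -/
theorem ChangGurskyYang_of_blowupLimit_of_gvPathFacts :
    ricciFlow_blowupLimit_four →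
    gurskyViaclovsky_gradientEstimate_weighted_four → gurskyViaclovsky_hessianEstimate_weighted_four →
    gurskyViaclovsky_pathOpen_weighted_four → gurskyViaclovsky_pathClosed_weighted_four →
    ChangGurskyYang :=
  fun hbl hG hH hO hC ↦ ChangGurskyYang_of_blowupLimit_of_theorem14 hbl
    (changGurskyYang_theorem14_four_of_gvPathFacts hG hH hO hC)

/-- The same for the item's second route decl `WeylBudget.ChangGurskyYang`. [cite: ChangGurskyYang2003, Thm. A] -/
theorem ChangGurskyYang_weylBudget_of_blowupLimit_of_gvPathFacts :
    ricciFlow_blowupLimit_four →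
    gurskyViaclovsky_gradientEstimate_weighted_four → gurskyViaclovsky_hessianEstimate_weighted_four →
    gurskyViaclovsky_pathOpen_weighted_four → gurskyViaclovsky_pathClosed_weighted_four →
      Summit.SmoothPoincare4.SmoothPoincare4.Theses.WeylBudget.ChangGurskyYang :=
  ChangGurskyYang_of_blowupLimit_of_gvPathFacts

end Summit.SmoothPoincare4.SmoothPoincare4.Theorems.MargerinRails

end
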